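import Literature.NumberTheory.Transcendental.UnivExtAlgPoints
import Literature.NumberTheory.EllipticCurves.WeierstrassPMultiplication
import Literature.NumberTheory.EllipticCurves.WeierstrassTorsion
import HarnessLib

/-!
# `ℚ̄`-points of the universal vectorial extension are closed under division

Topic `Literature/NumberTheory/Transcendental`; a proofs-only file (theorems only) in
`namespace PeriodPair`, continuing `UnivExtAlgPoints.lean` (which proves that the `ℚ̄`-points
`E♮(ℚ̄)` of the universal vectorial extension of `E : y² = 4x³ − g₂x − g₃`, in the Lie coordinates
`(z, t)` of `PeriodPair.IsUnivExtAlgPoint`, form a group: `neg`, `add`, `sub`, `int_mul`).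

Here we prove the converse of `IsUnivExtAlgPoint.int_mul`:

* `PeriodPair.IsUnivExtAlgPoint.of_int_mul` — **if `(nz, nt)` exponentiates to a `ℚ̄`-point of
  `E♮` and `n ≠ 0`, then so does `(z, t)`**; equivalently (`isUnivExtAlgPoint_int_mul_iff`)
  `exp_{E♮}(nu) ∈ E♮(ℚ̄) ↔ exp_{E♮}(u) ∈ E♮(ℚ̄)`, and the division form
  `IsUnivExtAlgPoint.div_nat` (`(z/n, t/n)` is a `ℚ̄`-point when `(z, t)` is).

This is the statement "the division points `γ = exp_G(v)`, `v = u/ℓ`, of an algebraic point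
`γ' = exp_G(u)` are algebraic" with which the proof of the Semistability Theorem starts
(Baker–Wüstholz 2007, §6.8, proof of Thm. 6.15, p. 117: "We now replace `γ'` by an element
`γ = exp_G(v)` in `B` where `v = u/ℓ` … The coordinates of `γ` are contained in an extension `K_ℓ`
of `K` with `[K_ℓ : K] ≤ ℓ^{2n}`"), for the factor `E♮` of `G = 𝔾ₐ × 𝔾ₘ^ι × (E♮)^κ`; the degree
bound for the `℘`-coordinate is `PeriodPair.isIntegral_weierstrassP_of_int_mul`
(`WeierstrassPMultiplication.lean`).

Proof. Three cases. (a) `z ∈ Λ`: then `nz ∈ Λ` and the integer coordinates of `nz` are `n` times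
those of `z` (`int_coords_unique`), so `t − η(z) = (nt − η(nz))/n`. (b) `z ∉ Λ`, `nz ∈ Λ`
(torsion): `℘(z)` and `η(nz)/n − ζ(z)` are algebraic by the tree's `PeriodPair.torsion_dichotomy`
(`WeierstrassTorsion.lean`). (c) `z, nz ∉ Λ`: `℘(z)` is algebraic because `℘(nz)` is
(`PeriodPair.isAlgebraic_weierstrassP_of_int_mul`: `℘(z)` is a root of `Φₙ − ℘(nz) ΨSqₙ`), and
`nζ(z) − ζ(nz) ∈ ℚ̄` by `IsUnivExtAlgPoint.int_mul` applied to the `ℚ̄`-point `(z, ζ(z))`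
(`isAlgebraic_int_mul_zeta_sub`), whence `t − ζ(z) = ((nt − ζ(nz)) − (nζ(z) − ζ(nz)))/n`.

## References

* A. Baker, G. Wüstholz, *Logarithmic Forms and Diophantine Geometry*, New Math. Monogr. 9, CUP
  2007, §6.8, proof of Thm. 6.15, p. 117. [BakerWustholz2007]
* J. H. Silverman, *The Arithmetic of Elliptic Curves*, 2nd ed., GTM 106, Springer 2009,
  Exercise 3.7(d). [SilvermanAEC2009]
-/

noncomputable section

open Complex

namespace PeriodPair

variable {L : PeriodPair}

/-- Integer coordinates in the basis `ω₁, ω₂` are unique. [folklore] -/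
theorem int_coords_unique {m n m' n' : ℤ}
    (h : (m : ℂ) * L.ω₁ + n * L.ω₂ = m' * L.ω₁ + n' * L.ω₂) : m = m' ∧ n = n' := by
  have h' : ((m : ℝ) : ℂ) * L.ω₁ + ((n : ℝ) : ℂ) * L.ω₂ =
      ((m' : ℝ) : ℂ) * L.ω₁ + ((n' : ℝ) : ℂ) * L.ω₂ := by
    simpa only [Complex.ofReal_intCast] using h
  obtain ⟨h1, h2⟩ := real_coords_unique h'
  exact ⟨by exact_mod_cast h1, by exact_mod_cast h2⟩

/-- **The `ζ`-part of the multiplication formula is algebraic.** For algebraic `g₂, g₃`, `z ∉ Λ`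
with `℘(z)` algebraic and `nz ∉ Λ`: `nζ(z) − ζ(nz)` is algebraic (it is a rational function over
`ℚ(g₂, g₃)` of `℘(z), ℘'(z)`; obtained here from `IsUnivExtAlgPoint.int_mul` applied to the
`ℚ̄`-point `(z, ζ(z))` of `E♮`). [folklore] -/
theorem isAlgebraic_int_mul_zeta_sub (h₂ : IsAlgebraic ℚ L.g₂) (h₃ : IsAlgebraic ℚ L.g₃) {z : ℂ}
    (hz : z ∉ L.lattice) (h℘ : IsAlgebraic ℚ (℘[L] z)) {n : ℤ} (hnz : (n : ℂ) * z ∉ L.lattice) :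
    IsAlgebraic ℚ (n * L.weierstrassZeta z - L.weierstrassZeta (n * z)) := by
  have h0 : L.IsUnivExtAlgPoint z (L.weierstrassZeta z) :=
    Or.inr ⟨hz, h℘, by rw [sub_self]; exact isAlgebraic_zero⟩
  rcases h0.int_mul h₂ h₃ n with ⟨m, k, hmk, -⟩ | ⟨-, -, hζ⟩
  · exact absurd (hmk ▸ L.int_mul_add_int_mul_mem_lattice m k) hnz
  · exact hζ

/-- **`E♮(ℚ̄)` is closed under division by natural numbers** (for algebraic `g₂, g₃`): if
`(nz, nt)` exponentiates to a `ℚ̄`-point of `E♮` and `n ≥ 1`, then so does `(z, t)`.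
[cite: BakerWustholz2007, §6.8, proof of Thm. 6.15, p. 117] -/
theorem IsUnivExtAlgPoint.of_nat_mul (h₂ : IsAlgebraic ℚ L.g₂) (h₃ : IsAlgebraic ℚ L.g₃)
    {z t : ℂ} {n : ℕ} (hn : n ≠ 0) (h : L.IsUnivExtAlgPoint (n * z) (n * t)) :
    L.IsUnivExtAlgPoint z t := by
  have hn' : (n : ℂ) ≠ 0 := by exact_mod_cast hn
  have hnQ : IsAlgebraic ℚ (n : ℂ) := isAlgebraic_nat n
  by_cases hz : z ∈ L.lattice
  · -- (a) `z ∈ Λ`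
    obtain ⟨m', k', hz'⟩ := mem_lattice.mp hz
    rcases h with ⟨m, k, hmk, ha⟩ | ⟨hnz, -, -⟩
    · have e : ((n * m' : ℤ) : ℂ) * L.ω₁ + ((n * k' : ℤ) : ℂ) * L.ω₂ = m * L.ω₁ + k * L.ω₂ := by
        rw [← hmk, ← hz']; push_cast; ring
      obtain ⟨hm, hk⟩ := int_coords_unique e
      refine Or.inl ⟨m', k', hz'.symm, ?_⟩
      have e2 : t - (m' * L.η₁ + k' * L.η₂) = ((n : ℂ) * t - (m * L.η₁ + k * L.η₂)) / n := by
        rw [← hm, ← hk]; push_cast; field_simp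
      rw [e2]
      exact ha.div' hnQ
    · exact absurd (by simpa [nsmul_eq_mul] using nsmul_mem hz n) hnz
  · by_cases hnz : (n : ℂ) * z ∈ L.lattice
    · -- (b) torsion: `z ∉ Λ`, `nz ∈ Λ`
      rcases h with ⟨m, k, hmk, ha⟩ | ⟨hnz', -, -⟩
      · have hzq : z = ((m : ℂ) * L.ω₁ + k * L.ω₂) / n := by
          rw [← hmk]; field_simp
        rcases L.torsion_dichotomy h₂ h₃ m k (Nat.pos_of_ne_zero hn) with ⟨hdm, hdk⟩ | ⟨-, h℘, hζ⟩
        · exfalso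
          apply hz
          obtain ⟨m₁, rfl⟩ := hdm
          obtain ⟨k₁, rfl⟩ := hdk
          rw [hzq]
          have e : ((((n : ℤ) * m₁ : ℤ) : ℂ) * L.ω₁ + (((n : ℤ) * k₁ : ℤ) : ℂ) * L.ω₂) / n =
              m₁ * L.ω₁ + k₁ * L.ω₂ := by
            push_cast; field_simp
          rw [e]
          exact L.int_mul_add_int_mul_mem_lattice m₁ k₁
        · rw [← hzq] at h℘ hζ
          refine Or.inr ⟨hz, h℘, ?_⟩
          have e2 : t - L.weierstrassZeta z = ((n : ℂ) * t - (m * L.η₁ + k * L.η₂)) / n +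
              (((m : ℂ) * L.η₁ + k * L.η₂) / n - L.weierstrassZeta z) := by
            field_simp; ring
          rw [e2]
          exact (ha.div' hnQ).add hζ
      · exact absurd hnz hnz'
    · -- (c) generic: `z, nz ∉ Λ`
      rcases h with ⟨m, k, hmk, ha⟩ | ⟨-, h℘n, hζn⟩
      · exact absurd (hmk ▸ L.int_mul_add_int_mul_mem_lattice m k) hnz
      · have hnz_int : ((n : ℤ) : ℂ) * z ∉ L.lattice := by simpa using hnz
        have hn_int : (n : ℤ) ≠ 0 := by exact_mod_cast hn
        have h℘ : IsAlgebraic ℚ (℘[L] z) :=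
          isAlgebraic_weierstrassP_of_int_mul h₂ h₃ hz hn_int hnz_int (by simpa using h℘n)
        refine Or.inr ⟨hz, h℘, ?_⟩
        have hdiff := isAlgebraic_int_mul_zeta_sub h₂ h₃ hz h℘ hnz_int
        simp only [Int.cast_natCast] at hdiff
        have e2 : t - L.weierstrassZeta z = (((n : ℂ) * t - L.weierstrassZeta (n * z)) -
            (n * L.weierstrassZeta z - L.weierstrassZeta (n * z))) / n := by
          field_simp; ring
        rw [e2]
        exact (hζn.sub hdiff).div' hnQ

/-- **`E♮(ℚ̄)` is closed under division**: for algebraic `g₂, g₃` and `n ∈ ℤ ∖ {0}`, if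
`(nz, nt)` exponentiates to a `ℚ̄`-point of `E♮` then so does `(z, t)` — the division points
`exp(u/ℓ)` of an algebraic point `exp(u)` are algebraic (Baker–Wüstholz 2007, p. 117).
[cite: BakerWustholz2007, §6.8, proof of Thm. 6.15, p. 117] -/
theorem IsUnivExtAlgPoint.of_int_mul (h₂ : IsAlgebraic ℚ L.g₂) (h₃ : IsAlgebraic ℚ L.g₃)
    {z t : ℂ} {n : ℤ} (hn : n ≠ 0) (h : L.IsUnivExtAlgPoint (n * z) (n * t)) :
    L.IsUnivExtAlgPoint z t := by
  obtain ⟨N, rfl | rfl⟩ := Int.eq_nat_or_neg n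
  · have hN : N ≠ 0 := by rintro rfl; exact hn rfl
    exact IsUnivExtAlgPoint.of_nat_mul h₂ h₃ hN (by simpa using h)
  · have hN : N ≠ 0 := by rintro rfl; exact hn (by simp)
    have h' : L.IsUnivExtAlgPoint (N * (-z)) (N * (-t)) := by
      have ez : ((N : ℂ)) * (-z) = ((-(N : ℤ) : ℤ) : ℂ) * z := by push_cast; ring
      have et : ((N : ℂ)) * (-t) = ((-(N : ℤ) : ℤ) : ℂ) * t := by push_cast; ring
      rw [ez, et]
      exact h
    simpa using (IsUnivExtAlgPoint.of_nat_mul h₂ h₃ hN h').neg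

/-- `exp_{E♮}(nu) ∈ E♮(ℚ̄) ↔ exp_{E♮}(u) ∈ E♮(ℚ̄)` for `n ≠ 0` (algebraic `g₂, g₃`).
[cite: BakerWustholz2007, §6.8, proof of Thm. 6.15, p. 117] -/
theorem isUnivExtAlgPoint_int_mul_iff (h₂ : IsAlgebraic ℚ L.g₂) (h₃ : IsAlgebraic ℚ L.g₃)
    {z t : ℂ} {n : ℤ} (hn : n ≠ 0) :
    L.IsUnivExtAlgPoint (n * z) (n * t) ↔ L.IsUnivExtAlgPoint z t :=
  ⟨IsUnivExtAlgPoint.of_int_mul h₂ h₃ hn, fun h => h.int_mul h₂ h₃ n⟩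

/-- **Division points of `ℚ̄`-points of `E♮` are `ℚ̄`-points**: if `(z, t)` exponentiates to a
`ℚ̄`-point and `n ≥ 1`, so does `(z/n, t/n)`. [cite: BakerWustholz2007, §6.8, proof of Thm. 6.15, p. 117] -/
theorem IsUnivExtAlgPoint.div_nat (h₂ : IsAlgebraic ℚ L.g₂) (h₃ : IsAlgebraic ℚ L.g₃) {z t : ℂ}
    (h : L.IsUnivExtAlgPoint z t) {n : ℕ} (hn : n ≠ 0) :
    L.IsUnivExtAlgPoint (z / n) (t / n) := by
  have hn' : (n : ℂ) ≠ 0 := by exact_mod_cast hn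
  refine IsUnivExtAlgPoint.of_nat_mul h₂ h₃ hn ?_
  rwa [mul_div_cancel₀ _ hn', mul_div_cancel₀ _ hn']

end PeriodPair
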